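import Literature.NumberTheory.GelbartRogawski1991.DoubledWeilRepresentationAssemblyGen
import Literature.NumberTheory.GelbartRogawski1991.DoubledWeilRepresentationFiniteHalfGen
import Literature.NumberTheory.GelbartRogawski1991.DoubledWeilRepresentationRationalParabolicGen
import Literature.NumberTheory.GelbartRogawski1991.DoubledWeilRepresentationUndoublingGen
import HarnessLib

-- buildfix G11b-3 recipe (LEDGER B13-1/B13-3): elaborate sequentially so the trailing `attribute [implicit_reducible]`
-- block (reducibilityCoreExt is keyed to the async environment branch) is in force at `.olean` export.
set_option Elab.async false

/-!
# [GelbartRogawski1991, Prop. 3.1.1] for a general quadratic unitary dual-pair datum, from the per-place package and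
# the archimedean half — general `E/F`

General-quadratic-extension twin (namespace `GRConstructionGen`) of `CompatibleSplittingCMDoubling` (CM case, namespace
`GRConstruction`).  Composition of the doubling construction (`DoubledUnitaryGlobalSplittingDataGen` and its siblings):
for the datum `D = splittingDatum F E c N M e (TV ⊗ 1) (TW ⊗ 1) …` (`𝕍 = V ⊗_E W` with Gram matrices `TV`, `TW` over `F`
read in the quadratic extension `E/F`, conjugation `c`), `SplittingDatum.CompatibleSplitting` — the body of
[GelbartRogawski1991, §3.1 Prop. 3.1.1 p. 455 L1–2] for `G = U(𝕍)`, `Mp := adelicMpCont`, `i := r_F` — FOLLOWS from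
(i) a doubled Weil representation for SOME Hecke character of `E` (`compatibleSplitting_of_isDoubledWeilRep`:
S4 ∘ S3′ ∘ S3 ∘ S2, and `g ↦ g ⊕ 1` carries `G₁(F)` into `H(F)`, `inlG_rational`), hence from
(ii) a per-place package `FinLocalFamily χ 𝔪` and an archimedean half `IsArchHalf χ sa` for one Hecke character `χ` of `E`
(`compatibleSplitting_of_family_of_archHalf`).  Unlike the CM file no splitting character is chosen here (the CM choice
`χ|_{𝕀_{L⁺}} = ε_{L/L⁺}` enters only the construction of the two inputs); nothing is asserted.
-/

set_option autoImplicit false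

noncomputable section

open scoped Classical
open scoped Matrix Kronecker TensorProduct
open NumberField IsDedekindDomain
open Literature.RepresentationTheory.HeisenbergGroup
open Literature.NumberTheory.Automorphic
open Literature.NumberTheory.Weil1964
open Literature.NumberTheory.GaloisRepresentations

namespace Literature.NumberTheory.GelbartRogawski1991.GRConstructionGen

open UnitaryDualPair

variable (F : Type) [Field F] [NumberField F] (E : Type) [Field E] [NumberField E] [Algebra F E]
  [Algebra.IsQuadraticExtension F E]
variable (c : E ≃ₐ[F] E) {δ : E} (hcδ : c δ = -δ) (hδ : δ ≠ 0) {d : F} (hd : δ * δ = algebraMap F E d)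
variable {N M n : ℕ} (e : Fin N × Fin M ≃ Fin n)
  (TV : Matrix (Fin N) (Fin N) F) (hV : TV.IsSymm) (hVd : IsUnit TV.det)
  (TW : Matrix (Fin M) (Fin M) F) (hW : TW.IsSymm) (hWd : IsUnit TW.det)

omit [Algebra.IsQuadraticExtension F E] in
/-- the doubled hermitian form over `E` is the re-enumerated block form `J ⊕ (−J)`, `J = (TV ⊗ TW) ⊗_F E` re-enumerated by `e`.
[cite: GelbartRogawski1991, §3.1 Prop. 3.1.1 p. 455 L1–2] -/
theorem hermD_eq :
    hermD F E e TV TW =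
      Matrix.reindex (e₂ (n := n)) (e₂ (n := n))
        (Matrix.fromBlocks (Matrix.reindex e e (TV.map (algebraMap F E) ⊗ₖ TW.map (algebraMap F E))) 0 0
          (-Matrix.reindex e e (TV.map (algebraMap F E) ⊗ₖ TW.map (algebraMap F E)))) := by
  have hP : TV.map (algebraMap F E) ⊗ₖ TW.map (algebraMap F E) = (TV ⊗ₖ TW).map (algebraMap F E) :=
    UnitaryGroup.kronecker_map_map _ _ _
  set f : F → E := ⇑(algebraMap F E) with hf
  have hf0 : f 0 = 0 := by simp [hf]
  have hfn : ∀ a, f (-a) = -f a := fun a => by simp [hf]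
  unfold hermD gramD gramR
  rw [hP, ← hf]
  simp only [Matrix.reindex_apply, ← Matrix.submatrix_map, Matrix.fromBlocks_map, Matrix.map_zero f hf0,
    Matrix.map_neg f hfn]

/-- the RATIONAL-level `g ↦ g ⊕ 1`: `G₁(F) →* H(F)` (tree `reindexU`, `blockDiag`, cast along `hermD_eq`).
[cite: GelbartRogawski1991, §3.1 Prop. 3.1.1 p. 455 L1–2] -/
def inlGRat : UnitaryGroup.rationalPair F E c N M (TV.map (algebraMap F E)) (TW.map (algebraMap F E)) →*
    UnitaryGroup.rational F E c (n + n) (hermD F E e TV TW) :=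
  (Subgroup.inclusion (le_of_eq (congrArg (unitaryGroupOfForm (c : E →+* E))
      (hermD_eq F E e TV TW).symm))).comp <|
    (UnitaryGroup.reindexU _ (e₂ (n := n)) _).comp <|
      (UnitaryGroup.blockDiag _ _ _).comp <|
        (MonoidHom.prod ((UnitaryGroup.reindexU _ e _)) 1)

omit [Algebra.IsQuadraticExtension F E] in
/-- **`g ↦ g ⊕ 1` carries `G₁(F)` into `H(F)`**: `inlG (γ ⊗ 1) = (inlGRat γ) ⊗ 1`.
[cite: GelbartRogawski1991, §3.1 Prop. 3.1.1 p. 455 L1–2] -/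
theorem inlG_rationalPairToAdelic (γ : UnitaryGroup.rationalPair F E c N M
      (TV.map (algebraMap F E)) (TW.map (algebraMap F E))) :
    inlG F E c e TV TW (UnitaryGroup.rationalPairToAdelic F E c N M
        (TV.map (algebraMap F E)) (TW.map (algebraMap F E)) γ) =
      UnitaryGroup.toAdelic F E c (n + n) (hermD F E e TV TW)
        (inlGRat F E c e TV TW γ) := by
  apply Subtype.ext
  apply Units.ext
  set A := ((γ : GL (Fin N × Fin M) E) : Matrix (Fin N × Fin M) (Fin N × Fin M) E) with hA
  set φ := algebraMap E (AdeleRing (𝓞 E) E) with hφ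
  change Matrix.reindex (e₂ (n := n)) (e₂ (n := n)) (Matrix.fromBlocks (Matrix.reindex e e (A.map φ)) 0 0 1) =
    (Matrix.reindex (e₂ (n := n)) (e₂ (n := n)) (Matrix.fromBlocks (Matrix.reindex e e A) 0 0 1)).map φ
  simp only [Matrix.reindex_apply, ← Matrix.submatrix_map, Matrix.fromBlocks_map,
    Matrix.map_zero _ (map_zero φ), Matrix.map_one _ (map_zero φ) (map_one φ)]

omit [Algebra.IsQuadraticExtension F E] in
/-- `g ↦ g ⊕ 1` carries `G₁(F)` into `H(F)`. [cite: GelbartRogawski1991, §3.1 Prop. 3.1.1 p. 455 L1–2] -/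
theorem inlG_rational :
    ∀ γ ∈ (UnitaryGroup.rationalPairToAdelic F E c N M
        (TV.map (algebraMap F E)) (TW.map (algebraMap F E))).range, inlG F E c e TV TW γ ∈ ratH F E c e TV TW := by
  rintro _ ⟨γ, rfl⟩
  exact ⟨inlGRat F E c e TV TW γ, (inlG_rationalPairToAdelic F E c e TV TW γ).symm⟩


/-! ## The composition -/

/-- a per-place family gives a finite half (restatement of `S1fin_asm` from a `Nonempty` hypothesis).
[cite: GelbartRogawski1991, §3.1 Prop. 3.1.1 p. 455 L1–2] -/
theorem S1fin_of_family (χ : HeckeCharacter E) (𝔪 : ∀ v, PlaceMeasure F v)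
    (h𝓕 : Nonempty (FinLocalFamily F E c hcδ hδ hd e TV hV hVd TW hW hWd χ 𝔪)) :
    ∃ sf, IsFinHalf F E c hcδ hδ hd e TV hV hVd TW hW hWd χ sf :=
  h𝓕.elim fun 𝓕 => S1fin_asm F E c hcδ hδ hd e TV hV hVd TW hW hWd χ 𝔪 𝓕

/-- **S1**: a per-place family and an archimedean half give a doubled Weil representation.
[cite: GelbartRogawski1991, §3.1 Prop. 3.1.1 p. 455 L1–2] -/
theorem isDoubledWeilRep_of_family_of_archHalf (χ : HeckeCharacter E) (𝔪 : ∀ v, PlaceMeasure F v)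
    (h𝓕 : Nonempty (FinLocalFamily F E c hcδ hδ hd e TV hV hVd TW hW hWd χ 𝔪))
    (ha : ∃ sa, IsArchHalf F E c hcδ hδ hd e TV hV hVd TW hW hWd χ sa) :
    ∃ sD : HA F E c e TV TW →* MpD F e TV TW, IsDoubledWeilRep F E c hcδ hδ hd e TV hV hVd TW hW hWd χ sD :=
  (S1fin_of_family F E c hcδ hδ hd e TV hV hVd TW hW hWd χ 𝔪 h𝓕).elim fun _ hf =>
    ha.elim fun _ ha' => isDoubledWeilRep_of_halves F E c hcδ hδ hd e TV hV hVd TW hW hWd χ hf ha'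

/-- **S2 + S3 + S3′ + S4**: a doubled Weil representation (for ANY Hecke character) yields the compatible splitting of
the datum of record. [cite: GelbartRogawski1991, §3.1 Prop. 3.1.1 p. 455 L1–2] -/
theorem compatibleSplitting_of_isDoubledWeilRep (χ : HeckeCharacter E) {sD : HA F E c e TV TW →* MpD F e TV TW}
    (hs : IsDoubledWeilRep F E c hcδ hδ hd e TV hV hVd TW hW hWd χ sD) : (D F E c hcδ hδ hd e TV hV hVd TW hW hWd).CompatibleSplitting :=
  S4_undouble F E c hcδ hδ hd e TV hV hVd TW hW hWd hs.continuous hs.proj_eq fun γ hγ =>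
    S3'_propagate F E c hcδ hδ hd e TV hV hVd TW hW hWd χ hs (S3_parabolic_rational F E c hcδ hδ hd e TV hV hVd TW hW hWd χ hs)
      (S2_ratH_normalClosure_siegel F E c hcδ hδ e TV hV hVd TW hW hWd) _ (inlG_rational F E c e TV TW γ hγ)

include hVd hWd in
/-- **[GelbartRogawski1991, Prop. 3.1.1] at a general quadratic dual-pair datum, from the two analytic inputs**: a
per-place family (for some Haar data) and an archimedean half, for one Hecke character `χ` of `E`, give
`(splittingDatum …).CompatibleSplitting`. [cite: GelbartRogawski1991, §3.1 Prop. 3.1.1 p. 455 L1–2] -/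
theorem compatibleSplitting_of_family_of_archHalf (χ : HeckeCharacter E) (𝔪 : ∀ v, PlaceMeasure F v)
    (h𝓕 : Nonempty (FinLocalFamily F E c hcδ hδ hd e TV hV hVd TW hW hWd χ 𝔪))
    (ha : ∃ sa, IsArchHalf F E c hcδ hδ hd e TV hV hVd TW hW hWd χ sa) :
    (D F E c hcδ hδ hd e TV hV hVd TW hW hWd).CompatibleSplitting :=
  (isDoubledWeilRep_of_family_of_archHalf F E c hcδ hδ hd e TV hV hVd TW hW hWd χ 𝔪 h𝓕 ha).elim fun _ hs =>
    compatibleSplitting_of_isDoubledWeilRep F E c hcδ hδ hd e TV hV hVd TW hW hWd χ hs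

include hVd hWd in
/-- the same with the Haar data chosen (`nonempty_placeMeasure`): a per-place family for EVERY choice of Haar data and an
archimedean half, for one Hecke character `χ` of `E`, give the compatible splitting.
[cite: GelbartRogawski1991, §3.1 Prop. 3.1.1 p. 455 L1–2] -/
theorem compatibleSplitting_of_inputs (χ : HeckeCharacter E)
    (hfin : ∀ 𝔪 : ∀ v, PlaceMeasure F v, Nonempty (FinLocalFamily F E c hcδ hδ hd e TV hV hVd TW hW hWd χ 𝔪))
    (ha : ∃ sa, IsArchHalf F E c hcδ hδ hd e TV hV hVd TW hW hWd χ sa) :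
    (D F E c hcδ hδ hd e TV hV hVd TW hW hWd).CompatibleSplitting :=
  let 𝔪 : ∀ v, PlaceMeasure F v := fun v => Classical.choice (nonempty_placeMeasure F v)
  compatibleSplitting_of_family_of_archHalf F E c hcδ hδ hd e TV hV hVd TW hW hWd χ 𝔪 (hfin 𝔪) ha

/-! ### Build-lane note (ops-buildfix G11b-3 recipe, LEDGER B13-1, 2026-08-21)
`lean -o` (the hub build lane, never `lean`/the gate check) runs Lean 4.32's library-suggestion indexers
(`Lean.LibrarySuggestions.SymbolFrequency` / `SineQuaNon`, from their `exportEntriesFn`) over the statement of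
every local theorem that is not a denied premise; on this family's statements (very large dependent binder
telescopes through the theta-kernel / dual-pair data) that fold runs for tens of minutes to hours and the build
lane kills the job (incident G11b-3, run/shared/lean/ops/buildfix/G11b-3-DOSSIER.md). `isDeniedPremise` skips
`[implicit_reducible]` constants before any fold, and a reducibility status on a *theorem* is inert (Meta never
unfolds `thmInfo`; the kernel ignores the attribute), so the public theorems of this file are tagged
`[implicit_reducible]` purely to keep them out of that index. Only other effect: they are not offered by
`+suggestions` premise selectors. No statement or proof is changed; superseded if the operator lands a
deny-list form (`HarnessLib.PremiseIndex`). -/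
set_option allowUnsafeReducibility true in
attribute [implicit_reducible]
  hermD_eq inlG_rationalPairToAdelic inlG_rational S1fin_of_family
  isDoubledWeilRep_of_family_of_archHalf compatibleSplitting_of_isDoubledWeilRep
  compatibleSplitting_of_family_of_archHalf compatibleSplitting_of_inputs

end Literature.NumberTheory.GelbartRogawski1991.GRConstructionGen
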